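import Summits.Ventures.Crystal3D.Theorems.StickyWulffConstantCoaxialWallLawInPlaneRunEndsPred
import Summits.Ventures.Crystal3D.Theorems.StickyWulffConstantCoaxialWallLawLaminarEnd
import HarnessLib

/-!
# The laminar rung of `stub_coaxialTwoSlabAdhesion`: the stub's inequality for every filling on the common basal planes

HONEST FRAMING. Part of the venture `Summits/Ventures/Crystal3D` (cell `crystal3d-full`), helper
`--supports` the crux `CoaxialWallLaw` (stmt-Ventures-19481, `route-Ventures-StickyWulffConstant`),
REGISTERED line `WallLedgerF` (planner cf-p1 gen 16), open stub `stub_coaxialTwoSlabAdhesion`.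
RUNG CREDIT ONLY: the stub quantifies over ARBITRARY unit-separated fillings; here the filling is LAMINAR —
every ball lies in a basal plane `⟪L⁻¹(p − s₁), e₃⟫ ∈ √(2/3)·ℤ` of the shared frame, its IN-PLANE POSITION
BEING FREE (2D disorder, in-layer relaxations, rotated 2D domains, vacancies of any pattern).  This strictly
contains the on-site class of `…CoaxialWallLawLayered` (`laminar_of_onSite`).  F-C1 is not moved.

THE MECHANISM (census-free, multiplicity ONE).  Pick ONE signed in-plane class `v ∈ {u₁, u₂, u₂ − u₁}` and
charge BOTH grains along it: the rows of grain 1 rooted in the bottom sample and followed upwards along the slot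
`A₁ w = L(εv)`, and the rows of grain 2 rooted in the top sample and followed downwards along `A₂ w' = −A₁ w`.
Their located ends WITH PREDECESSOR (`…InPlaneRunEndsPred`) number `≥ (2/3)√2|⟪Lv, e₃⟫|πρ² − O(ρ)` each; the
two end sets are disjoint (`Λ₁ ∖ Λ₂` vs `Λ₂ ∖ Λ₁`); and every such end has `deg ≤ 11` by the laminar end law
(`…LaminarEnd`: a sixth in-layer contact would put a ball at the vacant successor).  So the payer sum is
`≥ (4/3)√2 |⟪Lv, e₃⟫| πρ² − O(ρ)` for each class; the best class carries half of
`Σ|⟪Lvᵢ, e₃⟫| ≥ √3 sin θ` (`two_mul_abs_ge_sum_three`, `coaxial_sine_le_inPlaneClasses`), and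
`…PayerAssembly.twoSlab_cross_le_of_deficit` gives the stub's shape with constant `√6/3 ≈ 0.8165 > ½`.

* `laminar_of_onSite` — the on-site class is laminar.
* `two_mul_abs_ge_sum_three` — `|x₁| + |x₂| + |x₂ − x₁| ≤ 2·max`.
* `laminar_payers_ge_class` — per class: `Σ_window (12 − deg) ≥ (4/3)√2|⟪Lv, e₃⟫|πρ² − 2(12√2π + 120R₀)ρ`.
* **`coaxialTwoSlabAdhesion_laminar_sharp`** — frame data `(L, s₁, s₂, σ, σ')`, `Λ₁ ≠ Λ₂`: for every laminar
  filling of the stub's cell (`R₀ = 10`), `cross ≤ D(Y) + (φ₁ + φ₂ − (√6/3)·√(1 − ⟪L e₃, e₃⟫²))πρ² + C(1+h)ρ`.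
* **`coaxialTwoSlabAdhesion_laminar`** — the stub `CoaxialTwoSlabAdhesion` VERBATIM (hypotheses, re-picked frame,
  constant `½`) with the single extra premise «`X` laminar for `(L, s₁)`» inside.

WHAT THIS IS NOT: nothing for balls between the basal planes (the off-plane residual is `…OffSite`'s budget);
incompatible origins (`s₂ − s₁` off the layer lattice in height) make the premise contradictory rather than
interesting; F-C1 not moved.
-/

noncomputable section

namespace Summit.Ventures.Crystal3D.Theorems

open Summit.Ventures.Crystal3D Finset
open Literature.MathematicalPhysics.StatisticalMechanics (fccStacking barlowStacking IsHaggSeq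
  contactDeficiency triangularVec₁ triangularVec₂ barlowOffset layerNormal)
open scoped InnerProductSpace

/-! ## Small facts -/

/-- **The on-site class is laminar**: a site `L(i u₁ + j u₂ + c w + k ν) + s` has frame height `k √(2/3)`. -/
theorem laminar_of_onSite
    (L : EuclideanSpace ℝ (Fin 3) ≃ₗᵢ[ℝ] EuclideanSpace ℝ (Fin 3)) (s : EuclideanSpace ℝ (Fin 3))
    (X : Finset (EuclideanSpace ℝ (Fin 3)))
    (hlay : ∀ p ∈ X, ∃ i j c k : ℤ, p = L ((i : ℝ) • triangularVec₁ (1 : ℝ) + (j : ℝ) • triangularVec₂ (1 : ℝ) +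
      (c : ℝ) • barlowOffset (1 : ℝ) + (k : ℝ) • layerNormal (Real.sqrt (2 / 3))) + s) :
    ∀ p ∈ X, ∃ k : ℤ, (L.symm (p - s)) 2 = k * Real.sqrt (2 / 3) := by
  intro p hp
  obtain ⟨i, j, c, k, rfl⟩ := hlay p hp
  refine ⟨k, ?_⟩
  rw [add_sub_cancel_right, LinearIsometryEquiv.symm_apply_apply]
  simp [triangularVec₁, triangularVec₂, barlowOffset, layerNormal]

/-- `|x₁| + |x₂| + |x₂ − x₁|` is twice the largest of the three. -/
theorem two_mul_abs_ge_sum_three (x₁ x₂ : ℝ) :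
    |x₁| + |x₂| + |x₂ - x₁| ≤ 2 * |x₁| ∨ |x₁| + |x₂| + |x₂ - x₁| ≤ 2 * |x₂| ∨
      |x₁| + |x₂| + |x₂ - x₁| ≤ 2 * |x₂ - x₁| := by
  rcases le_total 0 x₁ with h₁ | h₁ <;> rcases le_total 0 x₂ with h₂ | h₂ <;>
    rcases le_total x₁ x₂ with h₃ | h₃
  · right; left
    rw [abs_of_nonneg h₁, abs_of_nonneg h₂, abs_of_nonneg (by linarith : (0 : ℝ) ≤ x₂ - x₁)]; linarith
  · left
    rw [abs_of_nonneg h₁, abs_of_nonneg h₂, abs_of_nonpos (by linarith : x₂ - x₁ ≤ 0)]; linarith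
  · right; right
    rw [abs_of_nonneg h₁, abs_of_nonpos h₂, abs_of_nonpos (by linarith : x₂ - x₁ ≤ 0)]; linarith
  · right; right
    rw [abs_of_nonneg h₁, abs_of_nonpos h₂, abs_of_nonpos (by linarith : x₂ - x₁ ≤ 0)]; linarith
  · right; right
    rw [abs_of_nonpos h₁, abs_of_nonneg h₂, abs_of_nonneg (by linarith : (0 : ℝ) ≤ x₂ - x₁)]; linarith
  · right; right
    rw [abs_of_nonpos h₁, abs_of_nonneg h₂, abs_of_nonneg (by linarith : (0 : ℝ) ≤ x₂ - x₁)]; linarith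
  · left
    rw [abs_of_nonpos h₁, abs_of_nonpos h₂, abs_of_nonneg (by linarith : (0 : ℝ) ≤ x₂ - x₁)]; linarith
  · right; left
    rw [abs_of_nonpos h₁, abs_of_nonpos h₂, abs_of_nonpos (by linarith : x₂ - x₁ ≤ 0)]; linarith

/-! ## The per-class payer bound -/

open scoped Classical in
/-- **Per-class payer bound for laminar fillings**: both grains charged along one signed in-plane class.  See
the module docstring. -/
theorem laminar_payers_ge_class
    (A₁ : EuclideanSpace ℝ (Fin 3) ≃ₗᵢ[ℝ] EuclideanSpace ℝ (Fin 3)) (t₁ : EuclideanSpace ℝ (Fin 3))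
    (A₂ : EuclideanSpace ℝ (Fin 3) ≃ₗᵢ[ℝ] EuclideanSpace ℝ (Fin 3)) (t₂ : EuclideanSpace ℝ (Fin 3))
    (L : EuclideanSpace ℝ (Fin 3) ≃ₗᵢ[ℝ] EuclideanSpace ℝ (Fin 3)) (s₁ s₂ : EuclideanSpace ℝ (Fin 3))
    {σ σ' : ℤ → ℤ} (hσ : IsHaggSeq σ) (hσ' : IsHaggSeq σ')
    (hsub₁ : (fun p => A₁ p + t₁) '' fccStacking 1 (Real.sqrt (2 / 3)) ⊆
      (fun p => L p + s₁) '' barlowStacking 1 (Real.sqrt (2 / 3)) σ)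
    (hsub₂ : (fun p => A₂ p + t₂) '' fccStacking 1 (Real.sqrt (2 / 3)) ⊆
      (fun p => L p + s₂) '' barlowStacking 1 (Real.sqrt (2 / 3)) σ')
    (hne : (fun p => A₁ p + t₁) '' fccStacking 1 (Real.sqrt (2 / 3)) ≠
      (fun p => A₂ p + t₂) '' fccStacking 1 (Real.sqrt (2 / 3)))
    (X P₁ P₂ : Finset (EuclideanSpace ℝ (Fin 3))) (R₀ h ρ : ℝ) (hR₀ : 10 ≤ R₀) (hρ : R₀ ≤ ρ)
    (hX : ∀ p ∈ X, ∀ q ∈ X, p ≠ q → 1 ≤ dist p q)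
    (hcell : ∀ p ∈ X, -(2 * R₀) ≤ p 2 ∧ p 2 ≤ h + 2 * R₀ ∧ p 0 ^ 2 + p 1 ^ 2 ≤ ρ ^ 2)
    (hP₁X : P₁ ⊆ X) (hP₂X : P₂ ⊆ X)
    (hP₁ : ∀ p, p ∈ P₁ ↔ (p ∈ (fun q => A₁ q + t₁) '' fccStacking 1 (Real.sqrt (2 / 3)) ∧
      -(2 * R₀) ≤ p 2 ∧ p 2 ≤ -R₀ ∧ p 0 ^ 2 + p 1 ^ 2 ≤ ρ ^ 2))
    (hP₂ : ∀ p, p ∈ P₂ ↔ (p ∈ (fun q => A₂ q + t₂) '' fccStacking 1 (Real.sqrt (2 / 3)) ∧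
      h + R₀ ≤ p 2 ∧ p 2 ≤ h + 2 * R₀ ∧ p 0 ^ 2 + p 1 ^ 2 ≤ ρ ^ 2))
    (hlam : ∀ p ∈ X, ∃ k : ℤ, (L.symm (p - s₁)) 2 = k * Real.sqrt (2 / 3))
    (i j : ℤ) (hv : ‖(i : ℝ) • triangularVec₁ (1 : ℝ) + (j : ℝ) • triangularVec₂ 1‖ = 1) :
    4 / 3 * Real.sqrt 2 * |⟪L ((i : ℝ) • triangularVec₁ (1 : ℝ) + (j : ℝ) • triangularVec₂ 1),
        EuclideanSpace.single (2 : Fin 3) (1 : ℝ)⟫_ℝ| * Real.pi * ρ ^ 2 -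
        2 * ((12 * Real.sqrt 2 * Real.pi + 120 * R₀) * ρ) ≤
      ∑ z ∈ X.filter (fun z => -R₀ - 2 ≤ z 2 ∧ z 2 ≤ h + R₀ + 2),
        ((12 : ℝ) - ((X.filter fun q => dist z q = 1).card : ℝ)) := by
  set e₃ : EuclideanSpace ℝ (Fin 3) := EuclideanSpace.single (2 : Fin 3) (1 : ℝ) with he₃
  set v : EuclideanSpace ℝ (Fin 3) := (i : ℝ) • triangularVec₁ (1 : ℝ) + (j : ℝ) • triangularVec₂ 1 with hvdef
  set Λ₁ := (fun q => A₁ q + t₁) '' fccStacking 1 (Real.sqrt (2 / 3)) with hΛ₁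
  set Λ₂ := (fun q => A₂ q + t₂) '' fccStacking 1 (Real.sqrt (2 / 3)) with hΛ₂
  -- the class as a non-descending slot of grain 1 and a non-ascending slot of grain 2
  obtain ⟨ε, hε, w, hw, hAw, hup⟩ := exists_up_slot_of_inPlane_class A₁ t₁ L s₁ hσ hsub₁ i j hv
  have hε' : (-ε = 1 ∨ -ε = -1) := by rcases hε with h | h <;> rw [h] <;> norm_num
  obtain ⟨w', hw', hAw'⟩ := exists_slot_top_of_inPlane_class A₂ t₂ L s₂ hσ' hsub₂ i j hv hε'
  have hopp : A₂ w' = -A₁ w := by rw [hAw', hAw, neg_smul, map_neg]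
  have hdown : ⟪A₂ w', e₃⟫_ℝ ≤ 0 := by rw [hopp, inner_neg_left]; linarith
  have hE := card_inPlane_runEndsPred_ge_coaxial A₁ t₁ A₂ t₂ L s₁ s₂ hσ hσ' hsub₁ hsub₂ hne X P₁ P₂ R₀ h ρ hR₀ hρ
    hX hcell hP₁X hP₂X hP₁ hP₂ hw hup hε i j hAw
  have hF := card_inPlane_runEndsPred_top_ge_coaxial A₁ t₁ A₂ t₂ L s₁ s₂ hσ hσ' hsub₁ hsub₂ hne X P₁ P₂ R₀ h ρ
    hR₀ hρ hX hcell hP₁X hP₂X hP₁ hP₂ hw' hdown hε' i j hAw'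
  -- both slots carry the class flux
  have habs : |⟪A₁ w, e₃⟫_ℝ| = |⟪L v, e₃⟫_ℝ| := by
    rw [hAw]
    rcases hε with h | h
    · rw [h, one_smul]
    · rw [h, neg_one_smul, map_neg, inner_neg_left, abs_neg]
  have habs' : |⟪A₂ w', e₃⟫_ℝ| = |⟪L v, e₃⟫_ℝ| := by rw [hopp, inner_neg_left, abs_neg, habs]
  rw [habs] at hE
  rw [habs'] at hF
  -- both slots are unit vectors of the basal plane
  have hvn : ⟪v, e₃⟫_ℝ = 0 := by
    rw [hvdef, inner_add_left, inner_smul_left, inner_smul_left, inner_triangularVec_e₃.1,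
      inner_triangularVec_e₃.2]
    simp
  have hdn : ⟪A₁ w, L e₃⟫_ℝ = 0 := by
    rw [hAw, LinearIsometryEquiv.inner_map_map, inner_smul_left, hvn, mul_zero]
  have hdn' : ⟪A₂ w', L e₃⟫_ℝ = 0 := by rw [hopp, inner_neg_left, hdn, neg_zero]
  have hd1 : ‖A₁ w‖ = 1 := by rw [LinearIsometryEquiv.norm_map, norm_eq_one_of_mem_fccSlots hw]
  have hd1' : ‖A₂ w'‖ = 1 := by rw [LinearIsometryEquiv.norm_map, norm_eq_one_of_mem_fccSlots hw']
  -- the window, the two end sets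
  set Xwin := X.filter fun z => -R₀ - 2 ≤ z 2 ∧ z 2 ≤ h + R₀ + 2 with hXwin
  set E₁ := X.filter fun e => e ∈ Λ₁ ∧ e ∉ Λ₂ ∧ e + A₁ w ∉ X ∧ e - A₁ w ∈ X ∧ -R₀ - 2 ≤ e 2 ∧
    e 2 ≤ h + R₀ + 2 with hE₁
  set E₂ := X.filter fun e => e ∈ Λ₂ ∧ e ∉ Λ₁ ∧ e + A₂ w' ∉ X ∧ e - A₂ w' ∈ X ∧ -R₀ - 2 ≤ e 2 ∧
    e 2 ≤ h + R₀ + 2 with hE₂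
  have hdisj : Disjoint E₁ E₂ := by
    rw [Finset.disjoint_left]
    intro e h1 h2
    exact (mem_filter.1 h1).2.2.1 (mem_filter.1 h2).2.1
  have hsub : E₁ ∪ E₂ ⊆ Xwin := by
    intro e he
    rcases mem_union.1 he with h1 | h2
    · obtain ⟨heX, -, -, -, -, hlo, hhi⟩ := mem_filter.1 h1
      exact mem_filter.2 ⟨heX, hlo, hhi⟩
    · obtain ⟨heX, -, -, -, -, hlo, hhi⟩ := mem_filter.1 h2
      exact mem_filter.2 ⟨heX, hlo, hhi⟩
  -- every end pays one at itself; every window ball pays a non-negative amount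
  have hone : ∀ z ∈ E₁ ∪ E₂, (1 : ℝ) ≤ (12 : ℝ) - ((X.filter fun q => dist z q = 1).card : ℝ) := by
    intro z hz
    rcases mem_union.1 hz with h1 | h2
    · obtain ⟨hzX, -, -, hsucc, hpred, -, -⟩ := mem_filter.1 h1
      have h11 := laminar_card_contacts_le_eleven_of_end L s₁ X hX hlam hzX hd1 hdn hpred hsucc
      have h11' : (((X.filter fun q => dist z q = 1).card : ℕ) : ℝ) ≤ 11 := by exact_mod_cast h11
      linarith
    · obtain ⟨hzX, -, -, hsucc, hpred, -, -⟩ := mem_filter.1 h2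
      have h11 := laminar_card_contacts_le_eleven_of_end L s₁ X hX hlam hzX hd1' hdn' hpred hsucc
      have h11' : (((X.filter fun q => dist z q = 1).card : ℕ) : ℝ) ≤ 11 := by exact_mod_cast h11
      linarith
  have hnonneg : ∀ z ∈ Xwin, z ∉ E₁ ∪ E₂ → (0 : ℝ) ≤ (12 : ℝ) - ((X.filter fun q => dist z q = 1).card : ℝ) := by
    intro z _ _
    have := card_filter_dist_eq_one_le_twelve X hX z
    have h' : (((X.filter fun q => dist z q = 1).card : ℕ) : ℝ) ≤ 12 := by exact_mod_cast this
    linarith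
  have hcard : ((E₁.card : ℕ) : ℝ) + ((E₂.card : ℕ) : ℝ) = ∑ z ∈ E₁ ∪ E₂, (1 : ℝ) := by
    rw [sum_const, nsmul_eq_mul, mul_one, card_union_of_disjoint hdisj]; push_cast; ring
  calc 4 / 3 * Real.sqrt 2 * |⟪L v, e₃⟫_ℝ| * Real.pi * ρ ^ 2 - 2 * ((12 * Real.sqrt 2 * Real.pi + 120 * R₀) * ρ)
      ≤ ((E₁.card : ℕ) : ℝ) + ((E₂.card : ℕ) : ℝ) := by linarith
    _ = ∑ z ∈ E₁ ∪ E₂, (1 : ℝ) := hcard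
    _ ≤ ∑ z ∈ E₁ ∪ E₂, ((12 : ℝ) - ((X.filter fun q => dist z q = 1).card : ℝ)) := sum_le_sum hone
    _ ≤ ∑ z ∈ Xwin, ((12 : ℝ) - ((X.filter fun q => dist z q = 1).card : ℝ)) :=
        sum_le_sum_of_subset_of_nonneg hsub hnonneg

/-! ## The laminar rung -/

open scoped Classical in
/-- **The LAMINAR rung of `stub_coaxialTwoSlabAdhesion`, sharp form** (constant `√6/3`, explicit frame).  See
the module docstring. -/
theorem coaxialTwoSlabAdhesion_laminar_sharp
    (A₁ : EuclideanSpace ℝ (Fin 3) ≃ₗᵢ[ℝ] EuclideanSpace ℝ (Fin 3)) (t₁ : EuclideanSpace ℝ (Fin 3))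
    (A₂ : EuclideanSpace ℝ (Fin 3) ≃ₗᵢ[ℝ] EuclideanSpace ℝ (Fin 3)) (t₂ : EuclideanSpace ℝ (Fin 3))
    (L : EuclideanSpace ℝ (Fin 3) ≃ₗᵢ[ℝ] EuclideanSpace ℝ (Fin 3)) (s₁ s₂ : EuclideanSpace ℝ (Fin 3))
    {σ σ' : ℤ → ℤ} (hσ : IsHaggSeq σ) (hσ' : IsHaggSeq σ')
    (hsub₁ : (fun p => A₁ p + t₁) '' fccStacking 1 (Real.sqrt (2 / 3)) ⊆
      (fun p => L p + s₁) '' barlowStacking 1 (Real.sqrt (2 / 3)) σ)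
    (hsub₂ : (fun p => A₂ p + t₂) '' fccStacking 1 (Real.sqrt (2 / 3)) ⊆
      (fun p => L p + s₂) '' barlowStacking 1 (Real.sqrt (2 / 3)) σ')
    (hne : (fun p => A₁ p + t₁) '' fccStacking 1 (Real.sqrt (2 / 3)) ≠
      (fun p => A₂ p + t₂) '' fccStacking 1 (Real.sqrt (2 / 3))) :
    ∃ C R₀ : ℝ, 1 ≤ R₀ ∧ ∀ h : ℝ, 0 ≤ h → ∀ ρ : ℝ, R₀ ≤ ρ →
      ∀ X P₁ P₂ : Finset (EuclideanSpace ℝ (Fin 3)),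
      (∀ p ∈ X, ∀ q ∈ X, p ≠ q → 1 ≤ dist p q) → P₁ ⊆ X → P₂ ⊆ X \ P₁ →
      (∀ p ∈ X, -(2 * R₀) ≤ p 2 ∧ p 2 ≤ h + 2 * R₀ ∧ p 0 ^ 2 + p 1 ^ 2 ≤ ρ ^ 2) →
      (∀ p, p ∈ P₁ ↔ (p ∈ (fun q => A₁ q + t₁) '' fccStacking 1 (Real.sqrt (2 / 3)) ∧
        -(2 * R₀) ≤ p 2 ∧ p 2 ≤ -R₀ ∧ p 0 ^ 2 + p 1 ^ 2 ≤ ρ ^ 2)) →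
      (∀ p, p ∈ P₂ ↔ (p ∈ (fun q => A₂ q + t₂) '' fccStacking 1 (Real.sqrt (2 / 3)) ∧
        h + R₀ ≤ p 2 ∧ p 2 ≤ h + 2 * R₀ ∧ p 0 ^ 2 + p 1 ^ 2 ≤ ρ ^ 2)) →
      (∀ p ∈ X, ∃ k : ℤ, (L.symm (p - s₁)) 2 = k * Real.sqrt (2 / 3)) →
      ((((P₁ ×ˢ (X \ P₁)).filter fun pq => dist pq.1 pq.2 = 1).card : ℕ) : ℝ) +
        ((((P₂ ×ˢ ((X \ P₁) \ P₂)).filter fun pq => dist pq.1 pq.2 = 1).card : ℕ) : ℝ) ≤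
        contactDeficiency ((X \ P₁) \ P₂) +
          (Real.sqrt 2 / 4 * ∑ᶠ w ∈ {w ∈ fccStacking 1 (Real.sqrt (2 / 3)) | ‖w‖ = 1},
              |⟪w, A₁.symm (EuclideanSpace.single (2 : Fin 3) (1 : ℝ))⟫_ℝ| +
            Real.sqrt 2 / 4 * ∑ᶠ w ∈ {w ∈ fccStacking 1 (Real.sqrt (2 / 3)) | ‖w‖ = 1},
              |⟪w, A₂.symm (EuclideanSpace.single (2 : Fin 3) (1 : ℝ))⟫_ℝ| -
            (Real.sqrt 6 / 3 : ℝ) * Real.sqrt (1 - ⟪L (EuclideanSpace.single (2 : Fin 3) (1 : ℝ)),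
              (EuclideanSpace.single (2 : Fin 3) (1 : ℝ))⟫_ℝ ^ 2)) * Real.pi * ρ ^ 2 +
          C * (1 + h) * ρ := by
  set e₃ : EuclideanSpace ℝ (Fin 3) := EuclideanSpace.single (2 : Fin 3) (1 : ℝ) with he₃
  set s : ℝ := Real.sqrt (1 - ⟪L e₃, e₃⟫_ℝ ^ 2) with hs
  have hs0 : 0 ≤ s := Real.sqrt_nonneg _
  obtain ⟨Cpa, hCpa⟩ := twoSlab_cross_le_of_deficit A₁ t₁ A₂ t₂ 10 (by norm_num)
  set C₀ : ℝ := 2 * (12 * Real.sqrt 2 * Real.pi + 120 * 10) with hC₀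
  have hC₀0 : 0 ≤ C₀ := by positivity
  obtain ⟨hn₁, hn₂, hn₁₂⟩ := norm_triangularVec_one
  have hv₁ : (((1 : ℤ) : ℝ)) • triangularVec₁ (1 : ℝ) + (((0 : ℤ) : ℝ)) • triangularVec₂ (1 : ℝ) =
      triangularVec₁ 1 := by simp
  have hv₂ : (((0 : ℤ) : ℝ)) • triangularVec₁ (1 : ℝ) + (((1 : ℤ) : ℝ)) • triangularVec₂ (1 : ℝ) =
      triangularVec₂ 1 := by simp
  have hv₃ : (((-1 : ℤ) : ℝ)) • triangularVec₁ (1 : ℝ) + (((1 : ℤ) : ℝ)) • triangularVec₂ (1 : ℝ) =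
      triangularVec₂ 1 - triangularVec₁ 1 := by push_cast; module
  refine ⟨Cpa + C₀ / 2, 10, by norm_num, ?_⟩
  intro h hh ρ hρ X P₁ P₂ hX hP₁X hP₂X₁ hcell hP₁ hP₂ hlam
  have hP₂X : P₂ ⊆ X := hP₂X₁.trans sdiff_subset
  have hρ0 : (0 : ℝ) ≤ ρ := by linarith
  -- the three per-class payer bounds
  have h₁ := laminar_payers_ge_class A₁ t₁ A₂ t₂ L s₁ s₂ hσ hσ' hsub₁ hsub₂ hne X P₁ P₂ 10 h ρ le_rfl hρ hX hcell
    hP₁X hP₂X hP₁ hP₂ hlam 1 0 (by rw [hv₁]; exact hn₁)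
  have h₂ := laminar_payers_ge_class A₁ t₁ A₂ t₂ L s₁ s₂ hσ hσ' hsub₁ hsub₂ hne X P₁ P₂ 10 h ρ le_rfl hρ hX hcell
    hP₁X hP₂X hP₁ hP₂ hlam 0 1 (by rw [hv₂]; exact hn₂)
  have h₃ := laminar_payers_ge_class A₁ t₁ A₂ t₂ L s₁ s₂ hσ hσ' hsub₁ hsub₂ hne X P₁ P₂ 10 h ρ le_rfl hρ hX hcell
    hP₁X hP₂X hP₁ hP₂ hlam (-1) 1 (by rw [hv₃]; exact hn₁₂)
  rw [hv₁] at h₁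
  rw [hv₂] at h₂
  rw [hv₃] at h₃
  -- the best class carries half of the total flux, which carries the sine
  set x₁ : ℝ := ⟪L (triangularVec₁ 1), e₃⟫_ℝ with hx₁
  set x₂ : ℝ := ⟪L (triangularVec₂ 1), e₃⟫_ℝ with hx₂
  have hx₃ : ⟪L (triangularVec₂ 1 - triangularVec₁ 1), e₃⟫_ℝ = x₂ - x₁ := by
    rw [map_sub, inner_sub_left]
  rw [hx₃] at h₃
  have hflux : Real.sqrt 6 * s ≤ Real.sqrt 2 * (|x₁| + |x₂| + |x₂ - x₁|) := by
    have := coaxial_sine_le_inPlaneClasses L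
    rw [hx₃] at this
    exact this
  set S : ℝ := ∑ z ∈ X.filter (fun z => -(10 : ℝ) - 2 ≤ z 2 ∧ z 2 ≤ h + 10 + 2),
    ((12 : ℝ) - ((X.filter fun q => dist z q = 1).card : ℝ)) with hS
  have hpay : (2 / 3 * Real.sqrt 6 * s) * Real.pi * ρ ^ 2 - C₀ * (1 + h) * ρ ≤ S := by
    set Q : ℝ := Real.sqrt 2 * Real.pi * ρ ^ 2 with hQ
    have hQ0 : 0 ≤ Q := by positivity
    have e₁ : 4 / 3 * Real.sqrt 2 * |x₁| * Real.pi * ρ ^ 2 = 4 / 3 * |x₁| * Q := by rw [hQ]; ring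
    have e₂ : 4 / 3 * Real.sqrt 2 * |x₂| * Real.pi * ρ ^ 2 = 4 / 3 * |x₂| * Q := by rw [hQ]; ring
    have e₃' : 4 / 3 * Real.sqrt 2 * |x₂ - x₁| * Real.pi * ρ ^ 2 = 4 / 3 * |x₂ - x₁| * Q := by rw [hQ]; ring
    rw [e₁] at h₁
    rw [e₂] at h₂
    rw [e₃'] at h₃
    have eC : C₀ * ρ = 2 * ((12 * Real.sqrt 2 * Real.pi + 120 * 10) * ρ) := by rw [hC₀]; ring
    have hbest : 2 / 3 * (|x₁| + |x₂| + |x₂ - x₁|) * Q - C₀ * ρ ≤ S := by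
      rw [eC]
      rcases two_mul_abs_ge_sum_three x₁ x₂ with hm | hm | hm
      · have := mul_le_mul_of_nonneg_right hm hQ0
        linarith
      · have := mul_le_mul_of_nonneg_right hm hQ0
        linarith
      · have := mul_le_mul_of_nonneg_right hm hQ0
        linarith
    have h1 : Real.sqrt 6 * s * (Real.pi * ρ ^ 2) ≤ (|x₁| + |x₂| + |x₂ - x₁|) * Q := by
      have := mul_le_mul_of_nonneg_right hflux (show (0 : ℝ) ≤ Real.pi * ρ ^ 2 by positivity)
      have eQ : Real.sqrt 2 * (|x₁| + |x₂| + |x₂ - x₁|) * (Real.pi * ρ ^ 2) = (|x₁| + |x₂| + |x₂ - x₁|) * Q := by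
        rw [hQ]; ring
      linarith [eQ]
    have h2 : C₀ * ρ ≤ C₀ * (1 + h) * ρ := by
      have : 0 ≤ C₀ * h * ρ := by positivity
      linarith [show C₀ * (1 + h) * ρ = C₀ * ρ + C₀ * h * ρ by ring]
    have e4 : (2 / 3 * Real.sqrt 6 * s) * Real.pi * ρ ^ 2 = 2 / 3 * (Real.sqrt 6 * s * (Real.pi * ρ ^ 2)) := by ring
    rw [e4]
    linarith [h1, h2, hbest]
  -- the payer assembly
  have hfin := hCpa h hh ρ hρ X P₁ P₂ hX hP₁X hP₂X₁ hcell hP₁ hP₂ (2 / 3 * Real.sqrt 6 * s) C₀ hC₀0 hpay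
  have e63 : 2 / 3 * Real.sqrt 6 * s / 2 = Real.sqrt 6 / 3 * s := by ring
  rw [e63] at hfin
  linarith [hfin]

/-- **The LAMINAR rung of `stub_coaxialTwoSlabAdhesion`** — the stub's hypotheses and conclusion VERBATIM
(constant `½`, the frame re-picked as the given one), with the single extra premise «every ball of `X` lies in
a basal plane of the frame `(L, s₁)`» inside.  See the module docstring. -/
theorem coaxialTwoSlabAdhesion_laminar
    (A₁ : EuclideanSpace ℝ (Fin 3) ≃ₗᵢ[ℝ] EuclideanSpace ℝ (Fin 3)) (t₁ : EuclideanSpace ℝ (Fin 3))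
    (A₂ : EuclideanSpace ℝ (Fin 3) ≃ₗᵢ[ℝ] EuclideanSpace ℝ (Fin 3)) (t₂ : EuclideanSpace ℝ (Fin 3))
    (hcoax : ∃ (L : EuclideanSpace ℝ (Fin 3) ≃ₗᵢ[ℝ] EuclideanSpace ℝ (Fin 3))
        (s₁ s₂ : EuclideanSpace ℝ (Fin 3)) (σ σ' : ℤ → ℤ), IsHaggSeq σ ∧ IsHaggSeq σ' ∧
        (fun p => A₁ p + t₁) '' fccStacking 1 (Real.sqrt (2 / 3)) ⊆
          (fun p => L p + s₁) '' barlowStacking 1 (Real.sqrt (2 / 3)) σ ∧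
        (fun p => A₂ p + t₂) '' fccStacking 1 (Real.sqrt (2 / 3)) ⊆
          (fun p => L p + s₂) '' barlowStacking 1 (Real.sqrt (2 / 3)) σ')
    (hne : (fun p => A₁ p + t₁) '' fccStacking 1 (Real.sqrt (2 / 3)) ≠
      (fun p => A₂ p + t₂) '' fccStacking 1 (Real.sqrt (2 / 3))) :
    ∃ (L : EuclideanSpace ℝ (Fin 3) ≃ₗᵢ[ℝ] EuclideanSpace ℝ (Fin 3))
        (s₁ s₂ : EuclideanSpace ℝ (Fin 3)) (σ σ' : ℤ → ℤ), IsHaggSeq σ ∧ IsHaggSeq σ' ∧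
        (fun p => A₁ p + t₁) '' fccStacking 1 (Real.sqrt (2 / 3)) ⊆
          (fun p => L p + s₁) '' barlowStacking 1 (Real.sqrt (2 / 3)) σ ∧
        (fun p => A₂ p + t₂) '' fccStacking 1 (Real.sqrt (2 / 3)) ⊆
          (fun p => L p + s₂) '' barlowStacking 1 (Real.sqrt (2 / 3)) σ' ∧
    ∃ C R₀ : ℝ, 1 ≤ R₀ ∧ ∀ h : ℝ, 0 ≤ h → ∀ ρ : ℝ, R₀ ≤ ρ →
      ∀ X P₁ P₂ : Finset (EuclideanSpace ℝ (Fin 3)),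
      (∀ p ∈ X, ∀ q ∈ X, p ≠ q → 1 ≤ dist p q) → P₁ ⊆ X → P₂ ⊆ X \ P₁ →
      (∀ p ∈ X, -(2 * R₀) ≤ p 2 ∧ p 2 ≤ h + 2 * R₀ ∧ p 0 ^ 2 + p 1 ^ 2 ≤ ρ ^ 2) →
      (∀ p, p ∈ P₁ ↔ (p ∈ (fun q => A₁ q + t₁) '' fccStacking 1 (Real.sqrt (2 / 3)) ∧
        -(2 * R₀) ≤ p 2 ∧ p 2 ≤ -R₀ ∧ p 0 ^ 2 + p 1 ^ 2 ≤ ρ ^ 2)) →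
      (∀ p, p ∈ P₂ ↔ (p ∈ (fun q => A₂ q + t₂) '' fccStacking 1 (Real.sqrt (2 / 3)) ∧
        h + R₀ ≤ p 2 ∧ p 2 ≤ h + 2 * R₀ ∧ p 0 ^ 2 + p 1 ^ 2 ≤ ρ ^ 2)) →
      (∀ p ∈ X, ∃ k : ℤ, (L.symm (p - s₁)) 2 = k * Real.sqrt (2 / 3)) →
      ((((P₁ ×ˢ (X \ P₁)).filter fun pq => dist pq.1 pq.2 = 1).card : ℕ) : ℝ) +
        ((((P₂ ×ˢ ((X \ P₁) \ P₂)).filter fun pq => dist pq.1 pq.2 = 1).card : ℕ) : ℝ) ≤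
        contactDeficiency ((X \ P₁) \ P₂) +
          (Real.sqrt 2 / 4 * ∑ᶠ w ∈ {w ∈ fccStacking 1 (Real.sqrt (2 / 3)) | ‖w‖ = 1},
              |⟪w, A₁.symm (EuclideanSpace.single (2 : Fin 3) (1 : ℝ))⟫_ℝ| +
            Real.sqrt 2 / 4 * ∑ᶠ w ∈ {w ∈ fccStacking 1 (Real.sqrt (2 / 3)) | ‖w‖ = 1},
              |⟪w, A₂.symm (EuclideanSpace.single (2 : Fin 3) (1 : ℝ))⟫_ℝ| -
            (1 / 2 : ℝ) * Real.sqrt (1 - ⟪L (EuclideanSpace.single (2 : Fin 3) (1 : ℝ)),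
              (EuclideanSpace.single (2 : Fin 3) (1 : ℝ))⟫_ℝ ^ 2)) * Real.pi * ρ ^ 2 +
          C * (1 + h) * ρ := by
  obtain ⟨L, s₁, s₂, σ, σ', hσ, hσ', hsub₁, hsub₂⟩ := hcoax
  obtain ⟨C, R₀, hR₀, hmain⟩ := coaxialTwoSlabAdhesion_laminar_sharp A₁ t₁ A₂ t₂ L s₁ s₂ hσ hσ' hsub₁ hsub₂ hne
  refine ⟨L, s₁, s₂, σ, σ', hσ, hσ', hsub₁, hsub₂, C, R₀, hR₀, ?_⟩
  intro h hh ρ hρ X P₁ P₂ hX hP₁X hP₂X hcell hP₁ hP₂ hlam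
  have hfin := hmain h hh ρ hρ X P₁ P₂ hX hP₁X hP₂X hcell hP₁ hP₂ hlam
  have hs0 : 0 ≤ Real.sqrt (1 - ⟪L (EuclideanSpace.single (2 : Fin 3) (1 : ℝ)),
      (EuclideanSpace.single (2 : Fin 3) (1 : ℝ))⟫_ℝ ^ 2) := Real.sqrt_nonneg _
  have h6 : (1 / 2 : ℝ) ≤ Real.sqrt 6 / 3 := by
    have h4 : Real.sqrt 4 = 2 := by
      rw [show (4 : ℝ) = 2 ^ 2 by norm_num, Real.sqrt_sq (by norm_num)]
    have h46 : Real.sqrt 4 ≤ Real.sqrt 6 := Real.sqrt_le_sqrt (by norm_num)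
    rw [h4] at h46
    linarith
  have hρ0 : (0 : ℝ) ≤ Real.pi * ρ ^ 2 := by positivity
  nlinarith [hfin, mul_le_mul_of_nonneg_right h6 (mul_nonneg hs0 hρ0)]

end Summit.Ventures.Crystal3D.Theorems

end
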